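/-
Origin: expansion seat `planner-pub-hodgecm-pv01-g2-0`, handover #3 2026-08-18T05:03:50Z (`HOME/pub-hodgecm-pv01-g2/lean/Pv01g2/ReflexInflateDict.lean`, md5 30b910f2, 93 lines);
landed by the gen-6 packager in gate run 22 as `HodgeCM/CM/ReflexInflateDict.lean` (import ^import Prl2g3\.ReflexInflate\b→import HodgeCM.CM.ReflexInflate ×1; stripped 2 #print/#check/#eval lines).
-/
/-
Copyright: pub-hodgecm formalisation cell (harness21, 2026). New file (not vendored).
Origin: HOME/pub-hodgecm-pv01-g2/lean/Pv01g2/ReflexInflateDict.lean (WIP module `Pv01g2.ReflexInflateDict`;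
intended final place `HodgeCM/CM/ReflexInflateDict.lean` = module `HodgeCM.CM.ReflexInflateDict`).
IMPORT REWRITE on landing: `Prl2g3.ReflexInflate` → `HodgeCM.CM.ReflexInflate` (prl2-g3's run-22 handover).
Lands AFTER it (and after the landed `HodgeCM.PerL34.ReflexWelldef`, run 19).  (seat planner-pub-hodgecm-pv01-g2-0,
node owner of `ReflexWelldef`; answers GAPS prl2g3-G1 "ask: pv01-g2 (ReflexWelldef / aSet convention)".)
-/
import Summits.HodgeConjecture.HodgeCM.PerL34.ReflexWelldef
import Summits.HodgeConjecture.HodgeCM.CM.ReflexInflate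

/-!
# Dictionary: prl2-g3's `Φ(Ψ) = reflexInflate j ι₁ Ψ` IS [Y1neg]'s `A_Φ` (the inflated reflex type)

[Y1neg] v2 l. 183 (VERBATIM, as in `ReflexWelldef`): "Given moreover an element `φ^h ∈ Φ`, put
`A_Φ := {τ ∈ Gal(Q̄/Q) : φ^h ∈ τΦ} = {τ : τ⁻¹ ∘ φ^h ∈ Φ}`, `Φ^* := {τ|_{K^*_Φ} : τ ∈ A_Φ}`" — so `A_Φ`, read as a set
of embeddings of the big field, is BY DEFINITION the inflation of the reflex type `Φ^*` of `(K, Φ)` from the reflex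
field `K^*_Φ` (it is a union of cosets of `Stab(Φ) = Gal(Q̄/K^*_Φ)`: `ReflexWelldef.mul_mem_aSet_of_mem_stabilizer`),
and `Φ^*` is the Shimura–Taniyama reflex type (`{σ⁻¹|_{K^*} : σ ∈ Φ̃}`, `Φ̃ = {g : g φ^h ∈ Φ} = A_Φ⁻¹`, l. 190).

Here the big field is the Galois CM field `L` (automorphism group `L ≃+* L` acting on `Hom(K, L)` by composition),
`φ^h = j : K →+* L`, and a CM type `Ψ` of `K` with values in `ℂ` is read in `Hom(K, L)` through `ι₁ : L →+* ℂ`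
(`pullType ι₁ Ψ = {σ | ι₁ ∘ σ ∈ Ψ}`).  THEOREM `reflexInflateSet_eq`: prl2-g3's
`CMTypeOps.reflexInflateSet j ι₁ Ψ = {ι₁ ∘ g : g ∈ A_{pullType ι₁ Ψ}(φ^h := j)}` — i.e. `Φ(Ψ)` is the inflation to `L`
of the reflex type of `(K, Ψ)` in [Y1neg]'s (= the standard) convention, NOT of `(K, Ψ̄)`; and membership of
`ι₁ ∘ g` is literally `g ∈ A` (`comp_mem_reflexInflateSet_iff_mem_aSet`).  Pure kernel; no cited input.
-/

set_option autoImplicit false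

open scoped Pointwise

namespace HodgeCM
namespace CMTypeOps

open Literature.AlgebraicGeometry.Motives (CMType)
open HodgeCM.PerL34.ReflexWelldef (aSet mem_aSet)

variable {K L : CMField}

/-- `Aut(L)` acts on `Hom(K, L)` by post-composition (the action `τ ↦ τ ∘ (-)` of [Y1neg] l. 183 on embeddings).
SCOPED to `HodgeCM.CMTypeOps` (`open HodgeCM.CMTypeOps` to use the statements below). -/
scoped instance autActionHom : MulAction (L ≃+* L) (K →+* L) where
  smul g σ := g.toRingHom.comp σ
  one_smul σ := by
    ext x; rfl
  mul_smul g h σ := by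
    ext x; rfl

/-- (Ported verbatim from the HodgeCMPerL package; no docstring in the source.) -/
theorem smul_def (g : L ≃+* L) (σ : K →+* L) : g • σ = g.toRingHom.comp σ := rfl

/-- A `ℂ`-valued CM type of `K`, read as a set of `L`-valued embeddings through `ι₁`. -/
def pullType (ι₁ : L →+* ℂ) (Ψ : CMType K) : Set (K →+* L) := {σ | ι₁.comp σ ∈ Ψ.1}

/-- (Ported verbatim from the HodgeCMPerL package; no docstring in the source.) -/
theorem mem_pullType (ι₁ : L →+* ℂ) (Ψ : CMType K) (σ : K →+* L) : σ ∈ pullType ι₁ Ψ ↔ ι₁.comp σ ∈ Ψ.1 :=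
  Iff.rfl

/-- Membership: `ι₁ ∘ g ∈ Φ(Ψ)` iff `g ∈ A_{Ψ}` ([Y1neg]'s `A_Φ = {τ : τ⁻¹ ∘ φ^h ∈ Φ}` with `φ^h = j`). -/
theorem comp_mem_reflexInflateSet_iff_mem_aSet (j : K →+* L) (ι₁ : L →+* ℂ) (Ψ : CMType K) (g : L ≃+* L) :
    ι₁.comp g.toRingHom ∈ reflexInflateSet j ι₁ Ψ ↔ g ∈ aSet (pullType ι₁ Ψ) j := by
  rw [comp_mem_reflexInflateSet_iff, mem_aSet, mem_pullType]
  rfl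

/-- **`Φ(Ψ)` = [Y1neg]'s `A_Ψ` transported to `Hom(L, ℂ)` by `g ↦ ι₁ ∘ g`.** -/
theorem reflexInflateSet_eq (j : K →+* L) (ι₁ : L →+* ℂ) (Ψ : CMType K) :
    reflexInflateSet j ι₁ Ψ = (fun g : L ≃+* L => ι₁.comp g.toRingHom) '' aSet (pullType ι₁ Ψ) j := by
  ext τ
  constructor
  · rintro ⟨g, rfl, h⟩
    exact ⟨g, (comp_mem_reflexInflateSet_iff_mem_aSet j ι₁ Ψ g).mp ((comp_mem_reflexInflateSet_iff j ι₁ Ψ g).mpr h),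
      rfl⟩
  · rintro ⟨g, hg, rfl⟩
    exact (comp_mem_reflexInflateSet_iff_mem_aSet j ι₁ Ψ g).mpr hg

/-- The same for the certified CM type `reflexInflate j ι₁ hL Ψ` (needs `L/ℚ` Galois only for the CM-type axiom). -/
theorem reflexInflate_carrier_eq (j : K →+* L) (ι₁ : L →+* ℂ) (hL : IsGalois ℚ L) (Ψ : CMType K) :
    (reflexInflate j ι₁ hL Ψ).1 = (fun g : L ≃+* L => ι₁.comp g.toRingHom) '' aSet (pullType ι₁ Ψ) j :=
  reflexInflateSet_eq j ι₁ Ψ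

/-- `A_Ψ · Stab(Ψ) = A_Ψ` in this instance ([Y1neg] l. 191 easy half, from `ReflexWelldef`): `Φ(Ψ)` is inflated from
the reflex field `L^{Stab}` — right-multiplying `g` by an automorphism `u` stabilising `pullType ι₁ Ψ` does not change
membership. -/
theorem comp_mul_mem_reflexInflateSet_iff (j : K →+* L) (ι₁ : L →+* ℂ) (Ψ : CMType K) {u : L ≃+* L}
    (hu : u ∈ MulAction.stabilizer (L ≃+* L) (pullType ι₁ Ψ)) (g : L ≃+* L) :
    ι₁.comp (g * u).toRingHom ∈ reflexInflateSet j ι₁ Ψ ↔ ι₁.comp g.toRingHom ∈ reflexInflateSet j ι₁ Ψ := by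
  rw [comp_mem_reflexInflateSet_iff_mem_aSet, comp_mem_reflexInflateSet_iff_mem_aSet]
  exact PerL34.ReflexWelldef.mul_mem_aSet_of_mem_stabilizer _ j hu g

end CMTypeOps
end HodgeCM

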